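/-
Copyright (c) 2026 the pub-hodgecm-mathlib formalisation cell (harness21).  Prover seat hodgecm-mathlib-LH7-p04 (g13), 2026-09-03.  Line LH4 ∕ L2-3 «CM glue» of the dyadic
(D-UNR) road (fence `φ_θ` everywhere): the `hN`-FREE sibling of ★ `TypeTwoHermitianShiftBindersCM` §2 asked by «LH4» LH4-p01 (g12) 06:10Z for the (I) assembly's type-(2)
branch at `v ∣ 2`, where the H-side depth is read off an admissible Eisenstein centre and NOT off a discriminant exponent: the denominators are THREADED (valuations `hw2m hw1m`,
conjuncts 1∕3 of the eleven from ANY supplier: ★ `…_of_typeTwo`, ★ `…_of_disc_lt`, ★ `…_of_twoDeep`), no `hN`, no `hσc`, no `hg1 hu1`, no `hθv`.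
-/
import Literature.NumberTheory.Rogawski1990.TypeFreeHermitianShiftDenominatorsCM  -- ★ file A (this seat, p853704); brings ★ γ₃ §1 (`separable_of_map_evalRingHom`, `map_smul_add_smul_one`), ★ γ₁, ★ P3, ★ P2
import Literature.NumberTheory.Automorphic.MatrixGenMoebiusShift                 -- ★ (LH4-p01 (g12)) four-scalar kit: `map_genMoebius`
import HarnessLib

/-!
# The type-(2) hermitian shift at a CM place — the binders `hn′ ∧ hirr′ ∧ hreg′` WITHOUT a discriminant hypothesis (denominators threaded; no `|2| = 1`)

Topic `NumberTheory/Rogawski1990`; namespace `Literature.NumberTheory.Rogawski1990`.  THEOREMS ONLY (no definition, no instance, no notation, no named fact, no `sorry`); kernel lane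
`--supports stmt-HodgeConjecture-24833`.  Cell `pub/hodgecm-mathlib`, crux H413; line LH4, organ `stub_DyUnramCore` ∕ L2-3 (the (I) assembly `liftInterior_of_levelTwo_of_isUnramifiedIn`,
LH4-p01 (g12)), CM-glue road.  ★ p853697 `hermitianShifted_binders_of_typeTwo` (odd currency `exp(−(2N+1))`) and p853723 `hermitianShifted_binders_of_disc_exp` (any depth
`m ≥ 3`) both READ a discriminant valuation; at `v ∣ 2` the assembly's type-(2) branch has no such number in hand (★ (P2d-α) Eisenstein currency, LH4-p01 FINDING #15), and needs
only conjuncts 2–4.  This file: the same conclusions `|χ_{g′}(u′)|_w = exp(−(n−2))`, `χ_{g′_w}` rootless, `γ_H′` `G`-regular from the hermitian data, the shift equations, the two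
denominator VALUATIONS `|det((c−σθ)g + σθ)|_w = exp(−2)`, `|((c−σθ)u + σθ)_w| = exp(−1)` (threaded, ★'s syntactic forms), `χ_{g_w}` rootless and `|χ_g(u)|_w = exp(−n)`, `n ≥ 2`;
`disc χ_{g_w} ≠ 0` comes from rootlessness in characteristic `0` (★ γ₁ `exists_isRoot_charpoly_iff_isSquare_disc`: `0` is a square), `disc χ_{g′_w} ≠ 0` by ★ P2
`disc_genMoebius_fin_two` with the key scalar `c(1−c) ≠ 0`.  HONEST LABEL: HC_CM is proved only modulo the cell's 2 remaining named inputs (hLiu418, h413) until rung 0 closes;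
this file is an ASSEMBLY over ★ material and asserts nothing printed.

## References
* [Rogawski1990] J. D. Rogawski, *Automorphic Representations of Unitary Groups in Three Variables*, Ann. of Math. Stud. 123 (1990), §4.9 Prop. 4.9.1 (b) p. 55; §4.3 p. 42.
* [Kottwitz1986BaseChangeUnits] R. E. Kottwitz, *Base change for unit elements of Hecke algebras*, Compositio Math. 60 (1986), §2 pp. 244–247.
* [Flicker1998UnitaryFL] Y. Z. Flicker, *Elementary proof of the fundamental lemma for a unitary group*, Canad. J. Math. 50 (1998), §6.
-/

set_option autoImplicit false

noncomputable section

open NumberField IsDedekindDomain Matrix Polynomial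
open scoped MatrixGroups WithZero

namespace Literature.NumberTheory.Rogawski1990

open Literature.NumberTheory.Automorphic Literature.NumberTheory.Automorphic.UnitaryGroup Literature.NumberTheory.Automorphic.MoebiusShift
open Literature.NumberTheory.GaloisRepresentations Literature.NumberTheory.NumberFields

variable (L : Type) [Field L] [NumberField L] [IsCMField L] (v : HeightOneSpectrum (𝓞 ↥(maximalRealSubfield L)))
  (w : PlacesOver L v) (hw : IsCMField.complexConj L • w.1 = w.1)

include hw in
/-- **THE HERMITIAN-SHIFTED BINDERS WITHOUT A DISCRIMINANT HYPOTHESIS** (`hN`-free sibling of ★ `hermitianShifted_binders_of_typeTwo`, conjuncts 2–4): for `γ_H = (g, u)` at a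
non-split `w` with `χ_{g_w}` rootless and `|χ_g(u)|_w = exp(−n)`, `n ≥ 2`, `|c_w| = exp(−1)`, `θ + σθ = 1` (no `|θ_w| ≤ 1` needed), the two denominator valuations `|det((c−σθ)g + σθ)_w| = exp(−2)`,
`|((c−σθ)u + σθ)_w| = exp(−1)` THREADED, and any `γ_H′` on the carriers with `g′ = φ_θ(g)`, `u′ = φ_θ(u)` as matrices: `|χ_{g′}(u′)|_w = exp(−(n−2))`, `χ_{g′_w}` has no root in
`L_w`, and `γ_H′` is `G`-regular (★ P3 `valued_eval_charpoly_hermitianMoebius_of_exp`, `not_exists_isRoot_charpoly_genMoebius`; `disc χ_{g_w} ≠ 0` from rootlessness in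
characteristic `0`, `disc χ_{g′_w} ≠ 0` by ★ P2 `disc_genMoebius_fin_two`; ★ γ₃ §1 `separable_of_map_evalRingHom`; NO `|2|_w = 1`, NO discriminant valuation).
[cite: Flicker1998UnitaryFL, §6] [cite: Kottwitz1986BaseChangeUnits, §2 pp. 244–247] [cite: Rogawski1990, §4.9 Prop. 4.9.1 (b) p. 55; §4.3 p. 42] -/
theorem hermitianShifted_binders_of_typeTwo_of_valued_denominators
    (γH γH' : (cmDatum L 2 (Matrix.of fun i j : Fin 2 => if i.val + j.val + 1 = 2 then (1 : L) else 0)).Local v ×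
      (cmDatum L 1 (Matrix.of fun i j : Fin 1 => if i.val + j.val + 1 = 1 then (1 : L) else 0)).Local v)
    {c : LocalRing L v} (hc : Valued.v (c w) = WithZero.exp (-1 : ℤ))
    (θ : LocalRing L v) (hθ : θ + conjLocal L (IsCMField.complexConj L) v θ = 1)
    (h1 : ((γH'.1.val : GL (Fin 2) (LocalRing L v)).val : Matrix (Fin 2) (Fin 2) (LocalRing L v)) =
      (θ • ((γH.1.val : GL (Fin 2) (LocalRing L v)).val : Matrix (Fin 2) (Fin 2) (LocalRing L v)) + (c - θ) • 1) *
        ((c - conjLocal L (IsCMField.complexConj L) v θ) • ((γH.1.val : GL (Fin 2) (LocalRing L v)).val : Matrix (Fin 2) (Fin 2) (LocalRing L v)) +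
          conjLocal L (IsCMField.complexConj L) v θ • 1)⁻¹)
    (hu' : finGammaTwo L v γH' = (θ * finGammaTwo L v γH + (c - θ)) *
      Ring.inverse ((c - conjLocal L (IsCMField.complexConj L) v θ) * finGammaTwo L v γH + conjLocal L (IsCMField.complexConj L) v θ))
    (hw2m : Valued.v ((((c - conjLocal L (IsCMField.complexConj L) v θ) • ((γH.1.val : GL (Fin 2) (LocalRing L v)).val : Matrix (Fin 2) (Fin 2) (LocalRing L v)) +
        conjLocal L (IsCMField.complexConj L) v θ • (1 : Matrix (Fin 2) (Fin 2) (LocalRing L v))).det) w) = WithZero.exp (-2 : ℤ))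
    (hw1m : Valued.v (((c - conjLocal L (IsCMField.complexConj L) v θ) * finGammaTwo L v γH + conjLocal L (IsCMField.complexConj L) v θ) w) = WithZero.exp (-1 : ℤ))
    (hirr : ¬ ∃ x : w.1.adicCompletion L, (((γH.1.val : GL (Fin 2) (LocalRing L v)).val.map
        (Pi.evalRingHom (fun w' : PlacesOver L v => w'.1.adicCompletion L) w)).charpoly).IsRoot x)
    {n : ℕ} (hn2 : 2 ≤ n)
    (hn : Valued.v (((finCharpolyTwo L v γH).eval (finGammaTwo L v γH)) w) = WithZero.exp (-(n : ℤ))) :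
    Valued.v (((finCharpolyTwo L v γH').eval (finGammaTwo L v γH')) w) = WithZero.exp (-((n - 2 : ℕ) : ℤ)) ∧
    (¬ ∃ x : w.1.adicCompletion L, (((γH'.1.val : GL (Fin 2) (LocalRing L v)).val.map
        (Pi.evalRingHom (fun w' : PlacesOver L v => w'.1.adicCompletion L) w)).charpoly).IsRoot x) ∧
    IsLocalGRegular L v γH' := by
  have hv : Subsingleton (PlacesOver L v) := PlacesOver.subsingleton_of_smul_eq (IsCMField.complexConj L) (IsCMField.complexConj_ne_one L) w hw
  -- the threaded denominators are units of `E_v` (non-zero at the only place `w`)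
  have hne : ∀ {x : LocalRing L v} {z : ℤ}, Valued.v (x w) = WithZero.exp z → IsUnit x := fun {x z} hx =>
    isUnit_localRing_of_ne_zero_of_subsingleton L v hv fun h0 => by rw [h0, Pi.zero_apply, map_zero] at hx; exact WithZero.zero_ne_coe hx
  have hU2m := hne hw2m
  have hU1m := hne hw1m
  set evw : LocalRing L v →+* w.1.adicCompletion L := Pi.evalRingHom (fun w' : PlacesOver L v => w'.1.adicCompletion L) w with hevw
  set σw := galAdicCompletionMap (L := L) (IsCMField.complexConj L) hw with hσw
  set gw : Matrix (Fin 2) (Fin 2) (w.1.adicCompletion L) := ((γH.1.val : GL (Fin 2) (LocalRing L v)).val.map evw) with hgw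
  set uw : w.1.adicCompletion L := finGammaTwo L v γH w with huw
  set cw : w.1.adicCompletion L := c w with hcw
  obtain ⟨hc0, hc1, -, -, -, -⟩ := shift_parameter_facts hc
  -- characteristic zero: `2 ≠ 0` in `L_w` (no valuation hypothesis on `2` is used anywhere)
  haveI : CharZero (w.1.adicCompletion L) := charZero_of_injective_algebraMap (algebraMap L (w.1.adicCompletion L)).injective
  haveI : NeZero (2 : w.1.adicCompletion L) := ⟨two_ne_zero⟩
  -- the hermitian parameter at `w`
  have hSθ : evw (conjLocal L (IsCMField.complexConj L) v θ) = σw (θ w) :=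
    conjLocal_apply_eq_of_smul_eq (IsCMField.complexConj L) (IsCMField.complexConj_ne_one L) v w hw θ
  have hθw : θ w + σw (θ w) = 1 := by
    have h := congrFun hθ w
    rw [Pi.add_apply, Pi.one_apply] at h
    rw [← hSθ]; exact h
  -- `g′_w = φ_θ(g_w)` and `u′_w = φ_θ(u_w)`
  have hg'w : ((γH'.1.val : GL (Fin 2) (LocalRing L v)).val.map evw) =
      (θ w • gw + (cw - θ w) • (1 : Matrix (Fin 2) (Fin 2) (w.1.adicCompletion L))) *
        ((cw - σw (θ w)) • gw + σw (θ w) • (1 : Matrix (Fin 2) (Fin 2) (w.1.adicCompletion L)))⁻¹ := by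
    rw [h1, map_genMoebius evw _ _ _ _ _ hU2m, map_sub, map_sub, hSθ]
    rfl
  have hD2w : Valued.v (((cw - σw (θ w)) • gw + σw (θ w) • (1 : Matrix (Fin 2) (Fin 2) (w.1.adicCompletion L))).det) = WithZero.exp (-2 : ℤ) := by
    have e1 : (((c - conjLocal L (IsCMField.complexConj L) v θ) • ((γH.1.val : GL (Fin 2) (LocalRing L v)).val : Matrix (Fin 2) (Fin 2) (LocalRing L v)) +
        conjLocal L (IsCMField.complexConj L) v θ • (1 : Matrix (Fin 2) (Fin 2) (LocalRing L v))).det) w =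
        evw (((c - conjLocal L (IsCMField.complexConj L) v θ) • ((γH.1.val : GL (Fin 2) (LocalRing L v)).val : Matrix (Fin 2) (Fin 2) (LocalRing L v)) +
        conjLocal L (IsCMField.complexConj L) v θ • (1 : Matrix (Fin 2) (Fin 2) (LocalRing L v))).det) := rfl
    have e : (((c - conjLocal L (IsCMField.complexConj L) v θ) • ((γH.1.val : GL (Fin 2) (LocalRing L v)).val : Matrix (Fin 2) (Fin 2) (LocalRing L v)) +
        conjLocal L (IsCMField.complexConj L) v θ • (1 : Matrix (Fin 2) (Fin 2) (LocalRing L v))).det) w =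
        (((cw - σw (θ w)) • gw + σw (θ w) • (1 : Matrix (Fin 2) (Fin 2) (w.1.adicCompletion L))).det) := by
      rw [e1, RingHom.map_det, RingHom.mapMatrix_apply, map_smul_add_smul_one, map_sub, hSθ]
      rfl
    rw [← e]; exact hw2m
  have hscw : ((c - conjLocal L (IsCMField.complexConj L) v θ) * finGammaTwo L v γH + conjLocal L (IsCMField.complexConj L) v θ) w = (cw - σw (θ w)) * uw + σw (θ w) := by
    show evw ((c - conjLocal L (IsCMField.complexConj L) v θ) * finGammaTwo L v γH + conjLocal L (IsCMField.complexConj L) v θ) = _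
    rw [map_add, map_mul, map_sub, hSθ]
    rfl
  have hw1m' : Valued.v ((cw - σw (θ w)) * uw + σw (θ w)) = WithZero.exp (-1 : ℤ) := by rw [← hscw]; exact hw1m
  have huw' : finGammaTwo L v γH' w = (θ w * uw + (cw - θ w)) / ((cw - σw (θ w)) * uw + σw (θ w)) := by
    have hmul : finGammaTwo L v γH' * ((c - conjLocal L (IsCMField.complexConj L) v θ) * finGammaTwo L v γH + conjLocal L (IsCMField.complexConj L) v θ) =
        θ * finGammaTwo L v γH + (c - θ) := by
      rw [hu', mul_assoc, Ring.inverse_mul_cancel _ hU1m, mul_one]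
    have hmw := congrFun hmul w
    rw [Pi.mul_apply, hscw] at hmw
    have hne : (cw - σw (θ w)) * uw + σw (θ w) ≠ 0 := fun h => by
      rw [h, map_zero] at hw1m'; exact WithZero.zero_ne_coe hw1m'
    rw [eq_div_iff hne, hmw]
    rfl
  -- (2) the value `χ_{g′}(u′)`
  have hev : ∀ (γ : (cmDatum L 2 (Matrix.of fun i j : Fin 2 => if i.val + j.val + 1 = 2 then (1 : L) else 0)).Local v ×
      (cmDatum L 1 (Matrix.of fun i j : Fin 1 => if i.val + j.val + 1 = 1 then (1 : L) else 0)).Local v),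
      ((finCharpolyTwo L v γ).eval (finGammaTwo L v γ)) w = (((γ.1.val : GL (Fin 2) (LocalRing L v)).val.map evw).charpoly).eval (finGammaTwo L v γ w) := fun γ => by
    have e : ((finCharpolyTwo L v γ).eval (finGammaTwo L v γ)) w = evw ((finCharpolyTwo L v γ).eval (finGammaTwo L v γ)) := rfl
    rw [e, ← Polynomial.eval₂_at_apply, ← Polynomial.eval_map, finCharpolyTwo, ← Matrix.charpoly_map]
    rfl
  have hnw : Valued.v (gw.charpoly.eval uw) = WithZero.exp (-(n : ℤ)) := by rw [hgw, huw, ← hev]; exact hn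
  have hn' := valued_eval_charpoly_hermitianMoebius_of_exp σw hθw hc gw uw hD2w hw1m' hn2 hnw
  rw [← hg'w, ← huw'] at hn'
  rw [← hev] at hn'
  -- (3) no root: the key scalar `θσθ − (c−θ)(c−σθ) = c(1−c)` is non-zero
  have hD0 : ((cw - σw (θ w)) • gw + σw (θ w) • (1 : Matrix (Fin 2) (Fin 2) (w.1.adicCompletion L))).det ≠ 0 := fun h => by
    rw [h, map_zero] at hD2w; exact WithZero.zero_ne_coe hD2w
  have hc1' : (1 : w.1.adicCompletion L) - cw ≠ 0 := fun h => by
    rw [sub_eq_zero] at h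
    rw [← h, map_one] at hc1
    exact lt_irrefl _ hc1
  have hΔ : θ w * σw (θ w) - (cw - θ w) * (cw - σw (θ w)) ≠ 0 := by
    rw [hermitianPair_key_scalar σw hθw cw]
    exact mul_ne_zero hc0 hc1'
  have hirr' := not_exists_isRoot_charpoly_genMoebius gw (θ w) (cw - θ w) (σw (θ w)) (cw - σw (θ w)) hD0 hΔ hirr
  rw [← hg'w] at hirr'
  -- (4) `G`-regularity: separability at `w`, lifted to `E_v` (verbatim ★ γ₃)
  -- `disc χ_{g_w} ≠ 0` (rootless in characteristic `0`: `0` is a square) and `disc χ_{g′_w} ≠ 0` (★ P2 `disc_genMoebius_fin_two`, `c(1−c) ≠ 0`)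
  have hdiscg0 : gw.trace ^ 2 - 4 * gw.det ≠ 0 := fun h =>
    hirr ((exists_isRoot_charpoly_iff_isSquare_disc gw).2 ⟨0, by rw [h, mul_zero]⟩)
  have hdisc' : ((γH'.1.val : GL (Fin 2) (LocalRing L v)).val.map evw).trace ^ 2 - 4 * ((γH'.1.val : GL (Fin 2) (LocalRing L v)).val.map evw).det ≠ 0 := fun h => by
    have key := disc_genMoebius_fin_two gw (θ w) (cw - θ w) (σw (θ w)) (cw - σw (θ w)) hD0
    rw [← hg'w, h, zero_mul] at key
    exact (mul_ne_zero (pow_ne_zero 2 hΔ) hdiscg0) key.symm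
  have hval' : (((γH'.1.val : GL (Fin 2) (LocalRing L v)).val.map evw).charpoly).eval (finGammaTwo L v γH' w) ≠ 0 := fun h => by
    rw [hev, h, map_zero] at hn'; exact WithZero.zero_ne_coe hn'
  have hsepw := separable_charpoly_mul_X_sub_C _ _ hdisc' hval'
  have hreg' : IsLocalGRegular L v γH' := by
    have hgoal : (((γH'.1.val : GL (Fin 2) (LocalRing L v)).val : Matrix (Fin 2) (Fin 2) (LocalRing L v)).charpoly *
        ((γH'.2.val : GL (Fin 1) (LocalRing L v)).val : Matrix (Fin 1) (Fin 1) (LocalRing L v)).charpoly).Separable := by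
      refine separable_of_map_evalRingHom L v w hv _ ?_
      rw [Polynomial.map_mul, ← Matrix.charpoly_map, ← Matrix.charpoly_map]
      have hUc : (((γH'.2.val : GL (Fin 1) (LocalRing L v)).val : Matrix (Fin 1) (Fin 1) (LocalRing L v)).map evw).charpoly = X - C (finGammaTwo L v γH' w) := by
        rw [Matrix.charpoly, Matrix.det_fin_one, Matrix.charmatrix_apply_eq, Matrix.map_apply]
        rfl
      rw [hUc]
      exact hsepw
    simp only [IsLocalGRegular, IsGRegular, IsRegularElt, coe_endoEmb, coe_endoGL, Matrix.charpoly_reindex, Matrix.charpoly_fromBlocks_zero₁₂]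
    exact hgoal
  exact ⟨hn', hirr', hreg'⟩

end Literature.NumberTheory.Rogawski1990

end
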